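import Summits.AtomisticToContinuum.BoseEinsteinCondensation.Theorems.BECThomsonPrincipleGDTransferSeededBandEmptinessInt
import Summits.AtomisticToContinuum.BoseEinsteinCondensation.Theorems.BECThomsonPrincipleGDTransferSeededPairPotentialBoundInt
import Summits.AtomisticToContinuum.BoseEinsteinCondensation.Theorems.BECThomsonPrincipleGDTransferSeededDilationL32
import Summits.AtomisticToContinuum.BoseEinsteinCondensation.Theorems.BECThomsonPrincipleGDTransferSeededNearMinPhaseInt
import Summits.AtomisticToContinuum.BoseEinsteinCondensation.Theorems.BECThomsonPrincipleGDTransferSeededLocalConstancyInt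

/-!
# Route `BECThomsonPrinciple`, crux `GDTransfer` (stmt-AtomisticToContinuum-9482), line `seeded-continuity` —
# skeleton v7 CLOSED modulo the seed and the hard-core rest: periodic BEC for every profile without a hard core

Supports (does not close) stmt-AtomisticToContinuum-9482.  Composition file of skeleton v7 (lead c3, wave 2): the
five stubs of the square-integrable re-cut are LANDED — `stub_bandEmptinessInt` (p159291, over …PlainFormsInt p158035,
…PlainPairsInt p158469, …PlainInteractionInt p158745, …PlainPairCostInt p158931; needs only finiteness and an `L¹`
lift), `stub_pairPotentialBoundInt` (p157888), `stub_dilationL32` (p158117), `stub_nearMinPhaseInt` (p157814),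
`stub_localConstancyInt` (p157851) — so the glue `GDTransfer_of_integrable` (…SeededIntegrableDefs p157332)
specialises to:

* `sqIntegrable_periodicBEC_of_seed` — **given the seed, Gaussian domination implies periodic BEC for every
  admissible profile that is finite on `[0, ∞)` with square-integrable lift** (integrable singular cores such as
  `r⁻¹𝟙[r ≤ R]` included; v6 had the essentially bounded class);
* `essSqIntegrable_periodicBEC_of_seed` — the same for every profile a.e. equal to such a one (`stub_roughNull`);
* `GDTransfer_of_seed_of_hardCoreRest` — **the crux from the two remaining registered stubs**: the SEED
  `stub_noBalancedCat` and the hard-core rest `stub_hardCoreRest` (hard cores on a set of positive measure, non-`L²`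
  soft cores);
* `singularRest_of_hardCoreRest`, `essentiallyRough_of_hardCoreRest` — v7 refines v6 and v5.

No `sorry`, no new definitions; the two open statements enter only as hypotheses.
-/

noncomputable section

open MeasureTheory Filter
open scoped ENNReal NNReal

namespace Summit.AtomisticToContinuum.BoseEinsteinCondensation.Cruxes.GDTransfer.Seeded

open Literature.MathematicalPhysics.QuantumManyBody.BoseGas
open Summit.AtomisticToContinuum.BoseEinsteinCondensation.Theses.BECThomsonPrinciple
open Summit.AtomisticToContinuum.BoseEinsteinCondensation.Cruxes.GDTransfer.DysonDressedWitness
  (PeriodicBECFor gdTransfer_iff)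

/-- **Given the seed, Gaussian domination implies periodic BEC for every admissible profile that is finite on
`[0, ∞)` with square-integrable lift** (the connectedness assembly `stub_ivtGlue` over the landed count law, band
emptiness for integrable lifts, free corner, and local constancy by the `L^{3/2}` transport with the integrable
Ky Fan gap). -/
theorem sqIntegrable_periodicBEC_of_seed (hSeed : Sig.stub_noBalancedCat) (hG : GaussianDominationCan) :
    ∀ v : ℝ → ℝ≥0∞, IsRepulsiveFiniteRange v → IsSqIntegrableProfile v → PeriodicBECFor v :=
  fun v hv hi => stub_ivtGlue stub_countLaw hSeed v hv (stub_bandEmptinessInt hG v hv hi) (stub_freeCorner v hv)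
    (stub_localConstancyInt stub_nearMinPhaseInt stub_pairPotentialBoundInt stub_dilationL32 stub_countLaw v hv hi)

/-- **… and for every profile a.e. equal (as a radial lift) to an admissible square-integrable one**
(`stub_roughNull`: the periodic BEC statement depends on the profile only through the a.e. class of its lift). -/
theorem essSqIntegrable_periodicBEC_of_seed (hSeed : Sig.stub_noBalancedCat) (hG : GaussianDominationCan) :
    ∀ v : ℝ → ℝ≥0∞, IsRepulsiveFiniteRange v → IsEssSqIntegrableProfile v → PeriodicBECFor v := by
  intro v hv hess
  obtain ⟨w, hw, hwi, hae⟩ := hess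
  exact stub_roughNull v w hv hw hae (sqIntegrable_periodicBEC_of_seed hSeed hG w hw hwi)

/-- **Skeleton v7 closed modulo its two open stubs**: the crux from the SEED and the hard-core rest (registered
sub-goal; the five device / twin stubs of the square-integrable re-cut are discharged by their landed proofs). -/
theorem GDTransfer_of_seed_of_hardCoreRest : Summit.AtomisticToContinuum.BoseEinsteinCondensation.Cruxes.GDTransfer.Seeded.Sig.stub_noBalancedCat → Summit.AtomisticToContinuum.BoseEinsteinCondensation.Cruxes.GDTransfer.Seeded.Sig.stub_hardCoreRest → Summit.AtomisticToContinuum.BoseEinsteinCondensation.Theses.BECThomsonPrinciple.GDTransfer :=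
  fun hSeed hRest => GDTransfer_of_integrable hSeed stub_bandEmptinessInt stub_pairPotentialBoundInt stub_dilationL32
    stub_nearMinPhaseInt stub_localConstancyInt hRest

/-- v7 refines v6: the v6 rest stub follows from the v7 rest stub (its own hypotheses supply GD and the seed, which
feed `sqIntegrable_periodicBEC_of_seed`; `singularRest_of_integrable`). -/
theorem singularRest_of_hardCoreRest (hRest : Sig.stub_hardCoreRest) : Sig.stub_singularRest :=
  singularRest_of_integrable (fun hG hSeed => sqIntegrable_periodicBEC_of_seed hSeed hG) hRest

/-- … and hence the v5 rest stub as well (`essentiallyRough_of_singularRest`). -/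
theorem essentiallyRough_of_hardCoreRest (hRest : Sig.stub_hardCoreRest) : Sig.stub_essentiallyRough :=
  essentiallyRough_of_singularRest (singularRest_of_hardCoreRest hRest)

/-- Conversely the hard-core rest is implied by the crux (so it cannot be refuted short of refuting `GDTransfer`),
and so is the square-integrable conclusion; recorded as the pair. -/
theorem hardCoreRest_and_soft_of_gdTransfer (h : GDTransfer) :
    Sig.stub_hardCoreRest ∧ (GaussianDominationCan →
      ∀ v : ℝ → ℝ≥0∞, IsRepulsiveFiniteRange v → IsSqIntegrableProfile v → PeriodicBECFor v) :=
  ⟨hardCoreRest_of_gdTransfer h, fun hG v hv _ => (gdTransfer_iff.mp h) hG v hv⟩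

end Summit.AtomisticToContinuum.BoseEinsteinCondensation.Cruxes.GDTransfer.Seeded

end
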